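import Literature.Dynamics.Tilings.OllingerTiles
import Mathlib.Tactic.Ring
import Mathlib.Tactic.Linarith
import Mathlib.Tactic.NormNum
import HarnessLib

/-!
# Supertiles of Ollinger's substitution

The `n`-level images `S^n(t)` ("the `i`-level image of a letter `a ∈ Σ` by `s` is the coloring
`S^i(a)` with support `□_i`", Ollinger §1) of the `2 × 2` substitution of
`Literature/Dynamics/Tilings/OllingerTiles.lean`, as functions `cellS n t : ℕ → ℕ → Tile` on the
square `[0, 2^n)²` (cell `(i, j)`: column `i` to the east, row `j` to the north; by the recursion
"the cell `(i, j)` of `S^{n+1}(t)` is the cell `(i mod 2, j mod 2)` of the image of the cell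
`(i/2, j/2)` of `S^n(t)`"), and their basic properties:

* `good_cellS` — supertiles of good tiles consist of good tiles;
* `hmatch_cellS`, `vmatch_cellS` — **supertiles of good tiles are valid patterns** (adjacent
  cells match: inside one image by `hmatch_subst`, across two images by the matching transfer
  `hmatch_iff_blocks`); `hmatch_cellS_boundary`, `vmatch_cellS_boundary` — supertiles of two
  matching tiles match along their common side;
* `cellS_succ_quadrant` — the four quadrants of `S^{n+1}(t)` are the supertiles of the four cells
  of the image of `t` (the other recursion), whence `cellS_stable`: a tile sitting in cell `r` of
  its own image has NESTED supertiles;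
* the **seed** `seedA = x*`, `seedB`, `seedC`, `seedD`: a valid `2 × 2` pattern `[C D / A B]`
  each of whose tiles sits in the corresponding cell of its own image (`subst_seed…`,
  `hmatch_seedA_seedB`, …), from which an explicit tiling of the plane is assembled in
  `OllingerSFT.lean` ("The tile set `τ` admits at least one tiling", proof of Thm. 1).

## References

* N. Ollinger, *Two-by-Two Substitution Systems and the Undecidability of the Domino Problem*,
  CiE 2008, LNCS 5028, doi:10.1007/978-3-540-69407-6_51, §1 and §3 (proof of Thm. 1).
-/

namespace Literature.Dynamics.Tilings.Ollinger

open Tile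

/-- The parity bit of a natural number. [folklore] -/
def bit (i : ℕ) : Bool := decide (i % 2 = 1)

/-- [folklore] -/
theorem bit_of_mod_eq_zero {i : ℕ} (h : i % 2 = 0) : bit i = false := by
  unfold bit; simp [h]

/-- [folklore] -/
theorem bit_of_mod_eq_one {i : ℕ} (h : i % 2 = 1) : bit i = true := by
  unfold bit; simp [h]

/-- **The supertile of order `n` of `t`**: cell `(i, j)` of `S^n(t)`, `0 ≤ i, j < 2^n` (junk
values outside the square are never used). [cite: Ollinger2008, §1] -/
def cellS : ℕ → Tile → ℕ → ℕ → Tile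
  | 0, t, _, _ => t
  | n + 1, t, i, j => subst (bit i, bit j) (cellS n t (i / 2) (j / 2))

/-- [cite: Ollinger2008, §1] -/
@[simp] theorem cellS_zero (t : Tile) (i j : ℕ) : cellS 0 t i j = t := rfl

/-- [cite: Ollinger2008, §1] -/
theorem cellS_succ (n : ℕ) (t : Tile) (i j : ℕ) :
    cellS (n + 1) t i j = subst (bit i, bit j) (cellS n t (i / 2) (j / 2)) := rfl

/-- Supertiles of good tiles consist of good tiles. [cite: Ollinger2008, §3] -/
theorem good_cellS {t : Tile} (ht : t.good = true) (n i j : ℕ) : (cellS n t i j).good = true := by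
  induction n generalizing i j with
  | zero => exact ht
  | succ n ih => exact good_subst (ih _ _) _

/-! ### Supertiles are valid patterns -/

/-- **Horizontally adjacent cells of a supertile of a good tile match.**
[cite: Ollinger2008, §3 (proof of Thm. 1)] -/
theorem hmatch_cellS {t : Tile} (ht : t.good = true) (n : ℕ) {i j : ℕ} (hi : i + 1 < 2 ^ n)
    (hj : j < 2 ^ n) : hmatch (cellS n t i j) (cellS n t (i + 1) j) = true := by
  induction n generalizing i j with
  | zero => simp at hi
  | succ n ih =>
    rw [cellS_succ, cellS_succ]
    have hp := good_cellS ht n (i / 2) (j / 2)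
    have h2 : (2 : ℕ) ^ (n + 1) = 2 * 2 ^ n := by ring
    rcases Nat.mod_two_eq_zero_or_one i with he | ho
    · -- `i` even: both cells in the image of the same parent
      have e1 : (i + 1) / 2 = i / 2 := by omega
      rw [e1, bit_of_mod_eq_zero he, bit_of_mod_eq_one (by omega : (i + 1) % 2 = 1)]
      rcases Nat.mod_two_eq_zero_or_one j with hje | hjo
      · rw [bit_of_mod_eq_zero hje]; exact (hmatch_subst hp).1
      · rw [bit_of_mod_eq_one hjo]; exact (hmatch_subst hp).2
    · -- `i` odd: adjacent parents, matching transfer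
      have e1 : (i + 1) / 2 = i / 2 + 1 := by omega
      have hp' := good_cellS ht n (i / 2 + 1) (j / 2)
      have hpar := ih (i := i / 2) (j := j / 2) (by omega) (by omega)
      rw [hmatch_iff_blocks hp hp', Bool.and_eq_true] at hpar
      rw [e1, bit_of_mod_eq_one ho, bit_of_mod_eq_zero (by omega : (i + 1) % 2 = 0)]
      rcases Nat.mod_two_eq_zero_or_one j with hje | hjo
      · rw [bit_of_mod_eq_zero hje]; exact hpar.1
      · rw [bit_of_mod_eq_one hjo]; exact hpar.2

/-- **Vertically adjacent cells of a supertile of a good tile match.**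
[cite: Ollinger2008, §3 (proof of Thm. 1)] -/
theorem vmatch_cellS {t : Tile} (ht : t.good = true) (n : ℕ) {i j : ℕ} (hi : i < 2 ^ n)
    (hj : j + 1 < 2 ^ n) : vmatch (cellS n t i j) (cellS n t i (j + 1)) = true := by
  induction n generalizing i j with
  | zero => simp at hj
  | succ n ih =>
    rw [cellS_succ, cellS_succ]
    have hp := good_cellS ht n (i / 2) (j / 2)
    have h2 : (2 : ℕ) ^ (n + 1) = 2 * 2 ^ n := by ring
    rcases Nat.mod_two_eq_zero_or_one j with he | ho
    · have e1 : (j + 1) / 2 = j / 2 := by omega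
      rw [e1, bit_of_mod_eq_zero he, bit_of_mod_eq_one (by omega : (j + 1) % 2 = 1)]
      rcases Nat.mod_two_eq_zero_or_one i with hie | hio
      · rw [bit_of_mod_eq_zero hie]; exact (vmatch_subst hp).1
      · rw [bit_of_mod_eq_one hio]; exact (vmatch_subst hp).2
    · have e1 : (j + 1) / 2 = j / 2 + 1 := by omega
      have hp' := good_cellS ht n (i / 2) (j / 2 + 1)
      have hpar := ih (i := i / 2) (j := j / 2) (by omega) (by omega)
      rw [vmatch_iff_blocks hp hp', Bool.and_eq_true] at hpar
      rw [e1, bit_of_mod_eq_one ho, bit_of_mod_eq_zero (by omega : (j + 1) % 2 = 0)]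
      rcases Nat.mod_two_eq_zero_or_one i with hie | hio
      · rw [bit_of_mod_eq_zero hie]; exact hpar.1
      · rw [bit_of_mod_eq_one hio]; exact hpar.2

/-- **Supertiles of horizontally matching good tiles match along their common side**: the east
column of `S^n(a)` against the west column of `S^n(b)`. [cite: Ollinger2008, §3 (proof of Thm. 1)] -/
theorem hmatch_cellS_boundary {a b : Tile} (ha : a.good = true) (hb : b.good = true)
    (hab : hmatch a b = true) (n : ℕ) {j : ℕ} (hj : j < 2 ^ n) :
    hmatch (cellS n a (2 ^ n - 1) j) (cellS n b 0 j) = true := by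
  induction n generalizing j with
  | zero => simpa using hab
  | succ n ih =>
    rw [cellS_succ, cellS_succ]
    have h2 : (2 : ℕ) ^ (n + 1) = 2 * 2 ^ n := by ring
    have hpos : 0 < 2 ^ n := Nat.two_pow_pos n
    have e1 : (2 ^ (n + 1) - 1) / 2 = 2 ^ n - 1 := by omega
    have e2 : (2 ^ (n + 1) - 1) % 2 = 1 := by omega
    have hpar := ih (j := j / 2) (by omega)
    rw [hmatch_iff_blocks (good_cellS ha n _ _) (good_cellS hb n _ _), Bool.and_eq_true] at hpar
    rw [e1, bit_of_mod_eq_one e2, Nat.zero_div, bit_of_mod_eq_zero (by norm_num : 0 % 2 = 0)]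
    rcases Nat.mod_two_eq_zero_or_one j with hje | hjo
    · rw [bit_of_mod_eq_zero hje]; exact hpar.1
    · rw [bit_of_mod_eq_one hjo]; exact hpar.2

/-- **Supertiles of vertically matching good tiles match along their common side**: the north
row of `S^n(a)` against the south row of `S^n(c)`. [cite: Ollinger2008, §3 (proof of Thm. 1)] -/
theorem vmatch_cellS_boundary {a c : Tile} (ha : a.good = true) (hc : c.good = true)
    (hac : vmatch a c = true) (n : ℕ) {i : ℕ} (hi : i < 2 ^ n) :
    vmatch (cellS n a i (2 ^ n - 1)) (cellS n c i 0) = true := by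
  induction n generalizing i with
  | zero => simpa using hac
  | succ n ih =>
    rw [cellS_succ, cellS_succ]
    have h2 : (2 : ℕ) ^ (n + 1) = 2 * 2 ^ n := by ring
    have hpos : 0 < 2 ^ n := Nat.two_pow_pos n
    have e1 : (2 ^ (n + 1) - 1) / 2 = 2 ^ n - 1 := by omega
    have e2 : (2 ^ (n + 1) - 1) % 2 = 1 := by omega
    have hpar := ih (i := i / 2) (by omega)
    rw [vmatch_iff_blocks (good_cellS ha n _ _) (good_cellS hc n _ _), Bool.and_eq_true] at hpar
    rw [e1, bit_of_mod_eq_one e2, Nat.zero_div, bit_of_mod_eq_zero (by norm_num : 0 % 2 = 0)]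
    rcases Nat.mod_two_eq_zero_or_one i with hie | hio
    · rw [bit_of_mod_eq_zero hie]; exact hpar.1
    · rw [bit_of_mod_eq_one hio]; exact hpar.2

/-! ### The other recursion: quadrants of a supertile -/

/-- Offset of quadrant `r` of the square of side `2 · m`: `0` or `m`. [folklore] -/
def qoff (b : Bool) (m : ℕ) : ℕ := cond b m 0

/-- [folklore] -/
@[simp] theorem qoff_false (m : ℕ) : qoff false m = 0 := rfl

/-- [folklore] -/
@[simp] theorem qoff_true (m : ℕ) : qoff true m = m := rfl

/-- **The quadrants of `S^{n+1}(t)` are the supertiles of order `n` of the cells of the image of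
`t`**: `S^{n+1}(t) = S^n(s(t))` ("`S(C)(2z + c) = s(C(z))(c)`", iterated).
[cite: Ollinger2008, §1] -/
theorem cellS_succ_quadrant (n : ℕ) (t : Tile) (r : B2) {i j : ℕ} (hi : i < 2 ^ n)
    (hj : j < 2 ^ n) :
    cellS (n + 1) t (qoff r.1 (2 ^ n) + i) (qoff r.2 (2 ^ n) + j) = cellS n (subst r t) i j := by
  induction n generalizing i j with
  | zero =>
    have hi0 : i = 0 := by simpa using hi
    have hj0 : j = 0 := by simpa using hj
    subst hi0 hj0
    obtain ⟨_ | _, _ | _⟩ := r <;> rfl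
  | succ n ih =>
    have h2 : (2 : ℕ) ^ (n + 1) = 2 * 2 ^ n := by ring
    obtain ⟨r1, r2⟩ := r
    dsimp only at ih
    have hq1 : ∀ b : Bool, (qoff b (2 ^ (n + 1)) + i) / 2 = qoff b (2 ^ n) + i / 2 ∧
        bit (qoff b (2 ^ (n + 1)) + i) = bit i := by
      intro b
      cases b
      · simp
      · simp only [qoff_true]
        refine ⟨by omega, ?_⟩
        unfold bit
        congr 1
        simp only [eq_iff_iff]
        omega
    have hq2 : ∀ b : Bool, (qoff b (2 ^ (n + 1)) + j) / 2 = qoff b (2 ^ n) + j / 2 ∧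
        bit (qoff b (2 ^ (n + 1)) + j) = bit j := by
      intro b
      cases b
      · simp
      · simp only [qoff_true]
        refine ⟨by omega, ?_⟩
        unfold bit
        congr 1
        simp only [eq_iff_iff]
        omega
    rw [cellS_succ (n + 1) t, (hq1 r1).1, (hq1 r1).2, (hq2 r2).1, (hq2 r2).2,
      ih (i := i / 2) (j := j / 2) (by omega) (by omega), cellS_succ n (subst (r1, r2) t) i j]

/-- **Nested supertiles**: if `t` is the cell `r` of its own image, then `S^n(t)` is the quadrant
`r` of `S^{n+1}(t)`. [cite: Ollinger2008, §3 (proof of Thm. 1)] -/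
theorem cellS_stable {t : Tile} {r : B2} (hr : subst r t = t) (n : ℕ) {i j : ℕ} (hi : i < 2 ^ n)
    (hj : j < 2 ^ n) :
    cellS (n + 1) t (qoff r.1 (2 ^ n) + i) (qoff r.2 (2 ^ n) + j) = cellS n t i j := by
  rw [cellS_succ_quadrant n t r hi hj, hr]

/-! ### The seed -/

/-- The seed tile of the south-west quadrant: `x*`, the cell `11` of its image.
[cite: Ollinger2008, §3 (proof of Thm. 1)] -/
def seedA : Tile := xstar

/-- The seed tile of the south-east quadrant: the cell `01` of its image.
[cite: Ollinger2008, §3 (proof of Thm. 1)] -/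
def seedB : Tile := ⟨(false, true), .V (true, true) true (false, true)⟩

/-- The seed tile of the north-west quadrant: the cell `10` of its image.
[cite: Ollinger2008, §3 (proof of Thm. 1)] -/
def seedC : Tile := ⟨(true, false), .H (true, true) true (false, true)⟩

/-- The seed tile of the north-east quadrant: the cell `00` of its image.
[cite: Ollinger2008, §3 (proof of Thm. 1)] -/
def seedD : Tile := ⟨(false, false), .X (true, true)⟩

/-- The seed tiles are good. [cite: Ollinger2008, §3] -/
theorem good_seed : seedA.good = true ∧ seedB.good = true ∧ seedC.good = true ∧
    seedD.good = true := by decide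

/-- Each seed tile is the corresponding cell of its own image. [cite: Ollinger2008, §3 (proof of Thm. 1)] -/
theorem subst_seed : subst (true, true) seedA = seedA ∧ subst (false, true) seedB = seedB ∧
    subst (true, false) seedC = seedC ∧ subst (false, false) seedD = seedD := by decide

/-- The seed is a valid `2 × 2` pattern `[C D / A B]`: its four inside edges match.
[cite: Ollinger2008, §3 (proof of Thm. 1)] -/
theorem match_seed : hmatch seedA seedB = true ∧ hmatch seedC seedD = true ∧
    vmatch seedA seedC = true ∧ vmatch seedB seedD = true := by decide

end Literature.Dynamics.Tilings.Ollinger
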